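import Mathlib
import HarnessLib
import Literature.Analysis.FluidPDE.SereginSverakPressureLocalTypeI
import Literature.Analysis.FluidPDE.LocalTypeIWeakSerrinProofs

/-!
# Route `LocalSineTubeDoor`, crux `LocalPointZoom` (stmt-NavierStokesRegularity-20017) —
# support file 1: the viscosity-normalising zoom at a LOCALLY Type I point is a local Type I ball

Cell ns-regularity-ideate, seat p6 (route-directed support, `--supports stmt-NavierStokesRegularity-20017`).

The crux `LocalPointZoom` asks for the blow-up (zoom-in) limit at a point `x₀` where a classical Leray–Hopf
solution `u` on `[0,T)` is LOCALLY Type I in the ODE-rate sense — `‖u(t,x)‖ √(ν(T−t)) ≤ M` on ONE parabolic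
cylinder `B(x₀,ρ) × ((T−ρ²) ∨ 0, T)` — but not backward bounded.  The cell proved the GLOBAL-Type-I analogue
(`Cell.NsRegP1c.pointZoomLimit_holds`, Sketch4–8) from the tree zoom chain of
`Theorems.RellichScarTypeIBlowupProfile` / `Theorems.TypeICertificateLadderNoTypeIBlowup{TypeIMorrey,Morrey}`,
whose only uses of the global rate are (i) the Morrey bound feeding Albritton–Barker 2019 Lemma 2.6 and
(ii) the rate of the zoom.  This file supplies the LOCAL replacement of (i)+(ii):

* `exists_zoom_typeIBound_lt_top_of_localTypeI` — for `ν, T > 0`, a classical solution `(u,p)` on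
  `ℝ³ × [0,T)`, Leray–Hopf on `[0,T)`, locally Type I at `(x₀,T)` as above, there are `R ≤ ρ`, `α = R/ν`,
  `β = R²/ν ≤ min(ρ², T)` such that the zoom `v = α u ∘ Φ`, `π = α² q ∘ Φ` (`Φ(s,y) = (T + βs, x₀ + Ry)`, `q`
  Tao's gauge of the pressure) is a suitable weak solution of the unit-viscosity system in `Q(0,1)` in the
  class of Albritton–Barker Def. 2.1 (`IsSuitableWeakSolutionInBall 1 0`, with the zoomed classical gradient
  as weak gradient — the packaging block of the tree's `exists_zoom_typeIBound_lt_top_of_morrey`, verbatim),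
  the zoom obeys the Type-I RATE `‖v(s,y)‖ ≤ C₁/√(−s)` for `−1 < s < 0`, `‖y‖ < ρ/R` (`C₁ = α·max(M,0)/√(νβ)`),
  and `𝐈(Q(0,1/2)) < ⊤` by Albritton–Barker 2019 **Lemma 2.5** in the rate case (Remark 3.2; tree THEOREM
  `albrittonBarker2019_lemma_2_5_rate_holds`) — no Morrey bound is needed.

Sources: D. Albritton, T. Barker, arXiv:1811.00502, Def. 2.1, Lemma 2.5, Remark 3.2, §3; G. Seregin,
V. Šverák, ARMA 163 (2002) (the zoom block, tree `SereginSverak2002.*`).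
WHAT THIS IS NOT: not a claim about Navier–Stokes regularity; a support lemma for an OPEN crux of a DRAFT route.
-/

noncomputable section

namespace Summit.NavierStokesRegularity.NavierStokesRegularity.Theorems.LocalSineTubeDoorLocalPointZoomZoom

open Set Filter Topology MeasureTheory
open InnerProductSpace Function TopologicalSpace Metric
open Literature.Analysis.FluidPDE
open scoped ContDiff RealInnerProductSpace ENNReal NNReal

variable {ν T : ℝ} {u : ℝ → EuclideanSpace ℝ (Fin 3) → EuclideanSpace ℝ (Fin 3)}
  {p : ℝ → EuclideanSpace ℝ (Fin 3) → ℝ}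

/-- **The viscosity-normalising zoom about a LOCALLY Type I final-time point is a local Type I ball.**
For a classical solution on `[0, T)` (viscosity `ν > 0`), Leray–Hopf on `[0, T)`, with the local ODE-rate
Type I bound `‖u(t,x)‖ √(ν(T−t)) ≤ M` for `t ∈ [0,T)`, `t > T − ρ²`, `x ∈ B(x₀,ρ)`, there are `R, α, β > 0`,
`β = R²/ν`, `α = R/ν`, `β ≤ T`, `R ≤ ρ`, `β ≤ ρ²`, such that, with the gauged pressure `q = p − c(t)` and
`Φ(s, y) = (T + βs, x₀ + Ry)`, the pair `v = α u ∘ Φ`, `π = α² q ∘ Φ` is a suitable weak solution of the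
unit-viscosity system in `Q(0, 1)` (Albritton–Barker Def. 2.1) with the zoomed classical gradient as weak
gradient, `v` has the Type-I rate `‖v(s,y)‖ ≤ C₁/√(−s)` (`C₁ = α·max(M,0)/√(νβ)`) for `−1 < s < 0`,
`‖y‖ < ρ/R`, and `𝐈(Q(0, 1/2)) < ⊤` (Albritton–Barker 2019, Lemma 2.5 / Remark 3.2, rate case). -/
theorem exists_zoom_typeIBound_lt_top_of_localTypeI (hν : 0 < ν) (hT : 0 < T)
    (hsol : IsClassicalNSSolutionOn (Ico 0 T) ν 0 u p) (hLH : IsLerayHopfOn T ν 0 (u 0) u)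
    {x₀ : EuclideanSpace ℝ (Fin 3)} {ρ M : ℝ} (hρ : 0 < ρ)
    (hM : ∀ t ∈ Ico 0 T, T - ρ ^ 2 < t → ∀ x ∈ ball x₀ ρ, ‖u t x‖ * Real.sqrt (ν * (T - t)) ≤ M) :
    ∃ R α β : ℝ, 0 < R ∧ 0 < α ∧ 0 < β ∧ β = R ^ 2 / ν ∧ α = R / ν ∧ β ≤ T ∧ R ≤ ρ ∧ β ≤ ρ ^ 2 ∧
      IsSuitableWeakSolutionInBall 1 0 (α • stPull β R T x₀ u)
        (α ^ 2 • stPull β R T x₀ fun t x => p t x - (p t 0 - normalisedPressure (u t) 0)) ∧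
      HasWeakSpatialGradientOn (parabolicCylinderOpens 1 (0 : ℝ × EuclideanSpace ℝ (Fin 3)))
        (α • stPull β R T x₀ u) ((α * R) • stPull β R T x₀ fun t x => fderiv ℝ (u t) x) ∧
      (∀ s ∈ Ioo (-1 : ℝ) 0, ∀ y ∈ ball (0 : EuclideanSpace ℝ (Fin 3)) (ρ / R),
        ‖(α • stPull β R T x₀ u) s y‖ ≤ (α * max M 0 / Real.sqrt (ν * β)) / Real.sqrt (-s)) ∧
      typeIBound (parabolicCylinder (1 / 2) (0 : ℝ × EuclideanSpace ℝ (Fin 3)))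
        (α • stPull β R T x₀ u)
        (α ^ 2 • stPull β R T x₀ fun t x => p t x - (p t 0 - normalisedPressure (u t) 0))
        ((α * R) • stPull β R T x₀ fun t x => fderiv ℝ (u t) x) < ⊤ := by
  -- scales: `R ≤ ρ`, `R² / ν ≤ min (ρ²) T`
  set δ : ℝ := min (ρ ^ 2) T with hδ
  have hδpos : 0 < δ := lt_min (pow_pos hρ 2) hT
  have hδT : δ ≤ T := min_le_right _ _
  have hδρ : δ ≤ ρ ^ 2 := min_le_left _ _
  set R : ℝ := min ρ (Real.sqrt (ν * δ)) with hR
  have hRpos : 0 < R := lt_min hρ (Real.sqrt_pos.2 (by positivity))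
  have hRρ : R ≤ ρ := min_le_left _ _
  set α : ℝ := R / ν with hα
  set β : ℝ := R ^ 2 / ν with hβdef
  have hαpos : 0 < α := by positivity
  have hβpos : 0 < β := by positivity
  have hβeq : β = α * R := by rw [hβdef, hα]; field_simp
  have hβδ : β ≤ δ := by
    have h1 : R ≤ Real.sqrt (ν * δ) := min_le_right _ _
    have h2 : R ^ 2 ≤ ν * δ := by
      have := pow_le_pow_left₀ hRpos.le h1 2
      rwa [Real.sq_sqrt (by positivity)] at this
    rw [hβdef, div_le_iff₀ hν]; linarith
  have hβT : β ≤ T := hβδ.trans hδT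
  have hβρ : β ≤ ρ ^ 2 := hβδ.trans hδρ
  refine ⟨R, α, β, hRpos, hαpos, hβpos, rfl, rfl, hβT, hRρ, hβρ, ?_⟩
  -- the gauged pressure
  set q : ℝ → EuclideanSpace ℝ (Fin 3) → ℝ := fun t x => p t x - (p t 0 - normalisedPressure (u t) 0)
    with hq
  -- the `ν`-cylinder `(T - β, T) × B(x₀, R)` inside the slab, and its preimage `Q(0,1)`
  set PO : Opens (ℝ × EuclideanSpace ℝ (Fin 3)) :=
    ⟨Ioo (T - β) T ×ˢ ball x₀ R, isOpen_Ioo.prod isOpen_ball⟩ with hPO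
  have hPOslab : (PO : Set (ℝ × EuclideanSpace ℝ (Fin 3))) ⊆
      Ioo 0 T ×ˢ (univ : Set (EuclideanSpace ℝ (Fin 3))) := by
    rintro ⟨t, x⟩ ⟨ht, -⟩
    exact ⟨⟨by linarith [ht.1], ht.2⟩, mem_univ _⟩
  have hpre1 : stPreimage β R T x₀ PO =
      parabolicCylinderOpens 1 (0 : ℝ × EuclideanSpace ℝ (Fin 3)) := by
    apply Opens.ext
    rw [coe_stPreimage]
    have h := stAffine_preimage_cylinder_eq_parabolicCylinder hν hRpos T x₀ R
    rw [div_self hRpos.ne'] at h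
    exact h
  -- suitability of the zoom on `Q(0,1)` with unit viscosity
  have hsuit1 : IsSuitableWeakSolutionOn
      (parabolicCylinderOpens 1 (0 : ℝ × EuclideanSpace ℝ (Fin 3))) 1 0
      (α • stPull β R T x₀ u) (α ^ 2 • stPull β R T x₀ q) := by
    have h0 := (SereginSverak2002.isSuitableWeakSolutionOn_gauge_of_classical hν hT hsol hLH PO
      hPOslab).stRescale hαpos hRpos hβeq T x₀
    have hvisc : α * ν / R = 1 := by rw [hα, div_mul_cancel₀ R hν.ne', div_self hRpos.ne']
    have hforce : ((α ^ 2 * R) • stPull β R T x₀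
        (0 : ℝ → EuclideanSpace ℝ (Fin 3) → EuclideanSpace ℝ (Fin 3))) = 0 := by
      funext s y; simp [stPull]
    rw [hvisc, hforce, hpre1] at h0
    exact h0
  -- the zoomed classical gradient
  have hGu : HasWeakSpatialGradientOn PO u fun t x => fderiv ℝ (u t) x :=
    hasWeakSpatialGradientOn_of_contDiffOn isOpen_Ioo hPOslab
      ((SereginSverak2002.classical_Ioo hsol).smooth_velocity.of_le (by norm_cast))
  have hGv : HasWeakSpatialGradientOn (parabolicCylinderOpens 1 (0 : ℝ × EuclideanSpace ℝ (Fin 3)))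
      (α • stPull β R T x₀ u) ((α * R) • stPull β R T x₀ fun t x => fderiv ℝ (u t) x) := by
    rw [← hpre1]
    exact hGu.stRescale α hβpos hRpos T x₀
  -- the class `IsSuitableWeakSolutionInBall 1 0`
  have hball : IsSuitableWeakSolutionInBall 1 0 (α • stPull β R T x₀ u)
      (α ^ 2 • stPull β R T x₀ q) := by
    refine ⟨hsuit1, ?_, ⟨_, hGv, ?_⟩, ?_⟩
    · -- energy class
      set CE : ENNReal := ENNReal.ofReal (2 * VectorCalculus.kineticEnergy (u 0)) with hCE
      have hphys : ∀ᵐ t ∂(volume.restrict (Ioo (T + β * (-1)) (T + β * 0))),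
          ∫⁻ x in ball x₀ R, ‖u t x‖ₑ ^ 2 ≤ CE := by
        refine (ae_restrict_mem measurableSet_Ioo).mono fun t ht => ?_
        have htI : t ∈ Icc 0 T :=
          ⟨by nlinarith [ht.1], by have := ht.2; simp at this; exact this.le⟩
        exact (setLIntegral_le_lintegral _ _).trans (SereginSverak2002.eEnergy_le hν.le hLH htI)
      have h2 := ae_sliced_setLIntegral_ball_stRescale hβpos hRpos T x₀ x₀ R (-1) 0
        (fun t x => ‖u t x‖ₑ ^ 2) hphys
      rw [finrank_euclideanSpace_fin, sub_self, smul_zero, div_self hRpos.ne'] at h2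
      set C₁ : ENNReal := ‖α‖ₑ ^ 2 * (ENNReal.ofReal (R ^ 3)⁻¹ * CE) with hC₁
      have hC₁top : C₁ ≠ ⊤ :=
        ENNReal.mul_ne_top (by simp) (ENNReal.mul_ne_top ENNReal.ofReal_ne_top ENNReal.ofReal_ne_top)
      refine ⟨C₁.toNNReal, ?_⟩
      rw [ENNReal.coe_toNNReal hC₁top]
      have hset : Ioo ((0 : ℝ × EuclideanSpace ℝ (Fin 3)).1 - 1 ^ 2)
          (0 : ℝ × EuclideanSpace ℝ (Fin 3)).1 = Ioo (-1 : ℝ) 0 := by simp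
      rw [hset]
      filter_upwards [h2] with s hs
      have e : ∀ y : EuclideanSpace ℝ (Fin 3), ‖(α • stPull β R T x₀ u) s y‖ₑ ^ 2 =
          ‖α‖ₑ ^ 2 * ‖u (T + β * s) (x₀ + R • y)‖ₑ ^ 2 := by
        intro y
        rw [smul_stPull_apply, enorm_smul, mul_pow]
      simp only [e]
      rw [lintegral_const_mul' _ _ (by simp)]
      exact mul_le_mul' le_rfl hs
    · -- `∫_{Q(0,1)} |∇v|² < ⊤`
      have hpre : parabolicCylinder 1 (0 : ℝ × EuclideanSpace ℝ (Fin 3)) =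
          stAffine β R T x₀ ⁻¹' (Ioo (T - (R * 1) ^ 2 / ν) T ×ˢ ball x₀ (R * 1)) := by
        rw [hβdef, stAffine_preimage_cylinder_eq_parabolicCylinder hν hRpos T x₀ (R * 1),
          mul_div_cancel_left₀ (1 : ℝ) hRpos.ne']
        rfl
      rw [hpre, setLIntegral_frobeniusNormSq_stRescale hβpos hRpos T x₀ (α * R),
        finrank_euclideanSpace_fin]
      refine ENNReal.mul_lt_top (ENNReal.mul_lt_top ENNReal.ofReal_lt_top ENNReal.ofReal_lt_top) ?_
      refine lt_of_le_of_lt (lintegral_mono_set ?_)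
        (SereginSverak2002.lintegral_slab_frobeniusNormSq_fderiv_lt_top' hsol hLH)
      rw [mul_one]
      rintro ⟨t, x⟩ ⟨ht, -⟩
      refine ⟨⟨?_, ht.2⟩, mem_univ _⟩
      have : R ^ 2 / ν = β := rfl
      linarith [ht.1]
    · -- `π ∈ L^{3/2}(Q(0,1))`
      refine ⟨hsuit1.distributional.2.2.1.aestronglyMeasurable, ?_⟩
      have h32 : ((3 : ENNReal) / 2).toReal = 3 / 2 := by rw [ENNReal.toReal_div]; norm_num
      have h32top : (3 : ENNReal) / 2 ≠ ⊤ := (ENNReal.div_lt_top (by simp) (by simp)).ne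
      rw [eLpNorm_eq_lintegral_rpow_enorm_toReal (by norm_num) h32top, h32]
      refine ENNReal.rpow_lt_top_of_nonneg (by positivity) (ne_of_lt ?_)
      have hQ1 : parabolicCylinder 1 (0 : ℝ × EuclideanSpace ℝ (Fin 3)) =
          stAffine β R T x₀ ⁻¹' (PO : Set (ℝ × EuclideanSpace ℝ (Fin 3))) := by
        rw [← coe_stPreimage, hpre1]; rfl
      rw [hQ1]
      show ∫⁻ z in stAffine β R T x₀ ⁻¹' (PO : Set (ℝ × EuclideanSpace ℝ (Fin 3))),
          ‖(α ^ 2 • stPull β R T x₀ q) z.1 z.2‖ₑ ^ (3 / 2 : ℝ) < ⊤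
      rw [setLIntegral_enorm_rpow_stRescale hβpos hRpos T x₀ (α ^ 2) q _ (by norm_num)]
      refine ENNReal.mul_lt_top (ENNReal.mul_lt_top
        (ENNReal.rpow_lt_top_of_nonneg (by norm_num) enorm_ne_top) ENNReal.ofReal_lt_top) ?_
      exact lt_of_le_of_lt (lintegral_mono_set hPOslab)
        (SereginSverak2002.lintegral_slab_gauged_pressure_lt_top hν hT hsol hLH)
  -- the Type-I rate of the zoom on `(-1, 0) × B(0, ρ/R)` from the LOCAL rate of `u`
  set C₁ : ℝ := α * max M 0 / Real.sqrt (ν * β) with hC₁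
  have hrate : ∀ s ∈ Ioo (-1 : ℝ) 0, ∀ y ∈ ball (0 : EuclideanSpace ℝ (Fin 3)) (ρ / R),
      ‖(α • stPull β R T x₀ u) s y‖ ≤ C₁ / Real.sqrt (-s) := by
    intro s hs y hy
    have hs0 : 0 < -s := by linarith [hs.2]
    have htI : T + β * s ∈ Ico 0 T := by
      constructor
      · nlinarith [hs.1, hβT]
      · nlinarith [hs.2, hβpos]
    have htρ : T - ρ ^ 2 < T + β * s := by nlinarith [hs.1, hβρ, hβpos]
    have hx : x₀ + R • y ∈ ball x₀ ρ := by
      rw [mem_ball, dist_eq_norm, add_sub_cancel_left, norm_smul, Real.norm_of_nonneg hRpos.le]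
      have hy' : ‖y‖ < ρ / R := by simpa using hy
      calc R * ‖y‖ < R * (ρ / R) := mul_lt_mul_of_pos_left hy' hRpos
        _ = ρ := mul_div_cancel₀ ρ hRpos.ne'
    have hb := hM (T + β * s) htI htρ (x₀ + R • y) hx
    have hsq : Real.sqrt (ν * (T - (T + β * s))) = Real.sqrt (ν * β) * Real.sqrt (-s) := by
      rw [show ν * (T - (T + β * s)) = (ν * β) * (-s) by ring, Real.sqrt_mul (by positivity)]
    rw [hsq] at hb
    have hνβ : 0 < Real.sqrt (ν * β) := Real.sqrt_pos.2 (by positivity)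
    have hspos : 0 < Real.sqrt (-s) := Real.sqrt_pos.2 hs0
    have hb' : ‖u (T + β * s) (x₀ + R • y)‖ * (Real.sqrt (ν * β) * Real.sqrt (-s)) ≤ max M 0 :=
      hb.trans (le_max_left _ _)
    rw [smul_stPull_apply, norm_smul, Real.norm_of_nonneg hαpos.le, hC₁, div_div,
      le_div_iff₀ (by positivity)]
    calc α * ‖u (T + β * s) (x₀ + R • y)‖ * (Real.sqrt (ν * β) * Real.sqrt (-s))
        = α * (‖u (T + β * s) (x₀ + R • y)‖ * (Real.sqrt (ν * β) * Real.sqrt (-s))) := by ring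
      _ ≤ α * max M 0 := mul_le_mul_of_nonneg_left hb' hαpos.le
  -- the rate on the unit ball `Q(0,1)` (as `R ≤ ρ`, `B(0,1) ⊆ B(0, ρ/R)`) and A–B Lemma 2.5
  have hrateQ : ∀ t' x', (t', x') ∈ parabolicCylinder 1 (0 : ℝ × EuclideanSpace ℝ (Fin 3)) →
      ‖(α • stPull β R T x₀ u) t' x'‖ ≤ C₁ / Real.sqrt ((0 : ℝ × EuclideanSpace ℝ (Fin 3)).1 - t') := by
    intro t' x' hz
    rw [SuitableCompactness.mem_parabolicCylinder_zero] at hz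
    obtain ⟨⟨h1, h2⟩, h3⟩ := hz
    have hx' : x' ∈ ball (0 : EuclideanSpace ℝ (Fin 3)) (ρ / R) := by
      rw [mem_ball_zero_iff]
      have h1R : (1 : ℝ) ≤ ρ / R := by rw [le_div_iff₀ hRpos, one_mul]; exact hRρ
      simp only at h3
      exact lt_of_lt_of_le h3 h1R
    have h := hrate t' ⟨by simpa using h1, h2⟩ x' hx'
    simpa using h
  exact ⟨hball, hGv, hrate,
    albrittonBarker2019_lemma_2_5_rate_holds 0 _ _ C₁ hball hrateQ _ hGv (1 / 2) (by norm_num)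
      (by norm_num)⟩

end Summit.NavierStokesRegularity.NavierStokesRegularity.Theorems.LocalSineTubeDoorLocalPointZoomZoom

end
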